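import Summits.Ventures.DiscreteObjects.Hadamard.ConferenceGraph333PrimeSpectrum

/-!
# Automorphism GROUPS of srg(333,166,82,83): prime divisors of the order and `p² ∤ |G|` for `p ∈ {23, 37, 41, 83}` (kernel)

Framing: lottery ticket; floor = certified bounds/negative ranges.  Cell pub-namedobj (venture DiscreteObjects),
target (H) = `H(668)`, hadamard gen 29.  First GROUP-LEVEL lines of the automorphism census of `srg(333,166,82,83)` ⇔
symmetric `C(334)` (⇒ `H(668)`), on top of the element-level census of gen 28 (`ConferenceGraph333PrimeSpectrum`):
for a group `G` of adjacency-preserving permutations,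
* **`autGroup_prime_dvd_card`** — every prime divisor of `|G|` lies in `{2,3,5,7,11,13,17,23,37,41,83}` (Cauchy + the
  prime-order spectrum; `17` is removed by the gen-29 refinement `ConferenceGraph333OddFixedPoints`, not imported here);
* **`autGroup_sq_not_dvd_card`** — for a prime `p` with `p² > 333` whose fixed-point window lies below `p`, `p² ∤ |G|`:
  a subgroup `K` of order `p²` (Sylow) is commutative (Mathlib `IsPGroup.isMulCommutative_of_card_eq_prime_sq`); a point `x`
  moved by `K` has a `K`-orbit of size `p` (size divides `p²`, is `> 1`, and `p² > 333`), so its stabiliser has order `p` and —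
  `K` being abelian — fixes the whole orbit: an element of order `p` with `≥ p` fixed points, against the window;
* **`autGroup_card_not_dvd_23_37_41_83_sq`** — hence **`23², 37², 41², 83² ∤ |G|`** (windows `11, 0, 5, 1`): the `23`-, `37`-,
  `41`-, `83`-parts of `|Aut(srg(333,166,82,83))|` are `1` or `p`.
Structure of a HYPOTHETICAL object; ours (PROVISIONAL; standard permutation-group arguments).  No `sorry`, no new definitions.
-/

namespace Summit.Ventures.DiscreteObjects.Hadamard

open Finset MulAction

section sylow
variable {V : Type*} [Fintype V] [DecidableEq V]

/-- **Prime divisors of the order of an automorphism group** lie in the prime-order spectrum. -/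
theorem autGroup_prime_dvd_card (hV : Fintype.card V = 333) (A : Matrix V V ℤ)
    (h01 : ∀ x y, A x y = 0 ∨ A x y = 1) (hsymm : ∀ x y, A y x = A x y) (hdiag : ∀ x, A x x = 0)
    (hk : ∀ x, ∑ y, A x y = 166) (hsrg : ∀ x y, ∑ z, A x z * A z y = 83 * (1 + (if x = y then 1 else 0)) - A x y)
    (G : Subgroup (Equiv.Perm V)) (hG : ∀ g ∈ G, ∀ x y, A (g x) (g y) = A x y)
    {p : ℕ} (hp : p.Prime) (hdvd : p ∣ Nat.card G) :
    p = 2 ∨ p = 3 ∨ p = 5 ∨ p = 7 ∨ p = 11 ∨ p = 13 ∨ p = 17 ∨ p = 23 ∨ p = 37 ∨ p = 41 ∨ p = 83 := by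
  haveI := Fact.mk hp
  obtain ⟨g, hg⟩ := exists_prime_orderOf_dvd_card' p hdvd
  have hg' : orderOf (g : Equiv.Perm V) = p := by rw [Subgroup.orderOf_coe, hg]
  have hgp : (g : Equiv.Perm V) ^ p = 1 := by rw [← hg']; exact pow_orderOf_eq_one _
  have hg1 : (g : Equiv.Perm V) ≠ 1 := by
    intro h
    rw [h, orderOf_one] at hg'
    exact hp.one_lt.ne hg'
  exact aut_prime_spectrum hV A h01 hsymm hdiag hk hsrg hp (g : Equiv.Perm V) hgp hg1 (hG g g.2)

/-- **No subgroup of order `p²` below the window.**  If `p` is a prime with `p² > 333` such that every adjacency-preserving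
permutation `σ ≠ 1` with `σ^p = 1` has fewer than `p` fixed points, then `p² ∤ |G|` for every group `G` of
adjacency-preserving permutations. -/
theorem autGroup_sq_not_dvd_card (A : Matrix V V ℤ) (G : Subgroup (Equiv.Perm V))
    (hG : ∀ g ∈ G, ∀ x y, A (g x) (g y) = A x y) {p : ℕ} (hp : p.Prime) (hbig : Fintype.card V < p * p)
    (hwin : ∀ σ : Equiv.Perm V, σ ^ p = 1 → σ ≠ 1 → (∀ x y, A (σ x) (σ y) = A x y) →
      (univ.filter fun x => σ x = x).card < p) :
    ¬ p ^ 2 ∣ Nat.card G := by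
  intro hdvd
  haveI := Fact.mk hp
  obtain ⟨K, hK⟩ := Sylow.exists_subgroup_card_pow_prime p hdvd
  have hcomm : ∀ a b : K, a * b = b * a := fun a b =>
    (IsPGroup.isMulCommutative_of_card_eq_prime_sq hK).is_comm.comm a b
  have hsmul : ∀ (k : K) (y : V), k • y = ((k : G) : Equiv.Perm V) y := fun _ _ => rfl
  -- a non-trivial element of K and a point it moves
  have hpK : p ∣ Nat.card K := by rw [hK, pow_two]; exact dvd_mul_right p p
  obtain ⟨h, hh⟩ := exists_prime_orderOf_dvd_card' p hpK
  have hh' : orderOf ((h : G) : Equiv.Perm V) = p := by rw [Subgroup.orderOf_coe, Subgroup.orderOf_coe, hh]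
  have hh1 : ((h : G) : Equiv.Perm V) ≠ 1 := by
    intro e
    rw [e, orderOf_one] at hh'
    exact hp.one_lt.ne hh'
  obtain ⟨x, hx⟩ : ∃ x, ((h : G) : Equiv.Perm V) x ≠ x := by
    by_contra hc
    exact hh1 (Equiv.ext fun y => by by_contra hy; exact hc ⟨y, hy⟩)
  -- the K-orbit of x has size p
  have hidx : (stabilizer K x).index = (orbit K x).ncard := MulAction.index_stabilizer K x
  have hprod : (stabilizer K x).index * Nat.card (stabilizer K x) = p ^ 2 := by rw [Subgroup.index_mul_card, hK]
  have hdiv : (orbit K x).ncard ∣ p ^ 2 := by rw [← hidx]; exact Dvd.intro _ hprod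
  obtain ⟨i, hi, hi'⟩ := (Nat.dvd_prime_pow hp).mp hdiv
  have hle : (orbit K x).ncard ≤ Fintype.card V := by
    have := Set.ncard_le_card (orbit K x)
    rwa [Nat.card_eq_fintype_card] at this
  have hne1 : (orbit K x).ncard ≠ 1 := by
    intro h1
    obtain ⟨y, hy⟩ := Set.ncard_eq_one.mp h1
    have hxm : x ∈ orbit K x := mem_orbit_self x
    have hhx : h • x ∈ orbit K x := mem_orbit x h
    rw [hy, Set.mem_singleton_iff] at hxm hhx
    apply hx
    rw [← hsmul, hhx, ← hxm]
  have hi1 : i = 1 := by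
    rcases i with _ | _ | _ | i
    · rw [pow_zero] at hi'; exact absurd hi' hne1
    · rfl
    · rw [hi'] at hle; rw [pow_two] at hle; omega
    · omega
  rw [hi1, pow_one] at hi'
  have hstab : Nat.card (stabilizer K x) = p := by
    rw [hidx, hi', pow_two] at hprod
    exact Nat.eq_of_mul_eq_mul_left hp.pos hprod
  -- an element of order p in the stabiliser fixes the whole orbit
  obtain ⟨k, hk⟩ := exists_prime_orderOf_dvd_card' (G := stabilizer K x) p (by rw [hstab])
  set kperm : Equiv.Perm V := (((k : K) : G) : Equiv.Perm V) with hkperm_def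
  have hk' : orderOf kperm = p := by
    rw [hkperm_def, Subgroup.orderOf_coe, Subgroup.orderOf_coe, Subgroup.orderOf_coe, hk]
  have hkp : kperm ^ p = 1 := by rw [← hk']; exact pow_orderOf_eq_one _
  have hk1 : kperm ≠ 1 := by
    intro e
    rw [e, orderOf_one] at hk'
    exact hp.one_lt.ne hk'
  have hkA : ∀ a b, A (kperm a) (kperm b) = A a b := hG kperm ((k : K) : G).2
  have hfix : ∀ y ∈ orbit K x, kperm y = y := by
    rintro y ⟨k', rfl⟩
    have e : ((k : K) * k') • x = (k' * (k : K)) • x := by rw [hcomm]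
    rw [mul_smul, mul_smul, show (k : K) • x = x from mem_stabilizer_iff.mp k.2] at e
    show kperm (k' • x) = k' • x
    rw [hkperm_def, ← hsmul]
    exact e
  have hcount : p ≤ (univ.filter fun y => kperm y = y).card := by
    have hsub : orbit K x ⊆ ↑(univ.filter fun y => kperm y = y) := by
      intro y hy
      rw [Finset.mem_coe, Finset.mem_filter]
      exact ⟨Finset.mem_univ _, hfix y hy⟩
    have h1 := Set.ncard_le_ncard hsub
    rw [hi', Set.ncard_coe_finset] at h1
    exact h1
  exact absurd (hwin kperm hkp hk1 hkA) (not_lt.mpr hcount)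

/-- **`23², 37², 41², 83² ∤ |G|`** for every group `G` of automorphisms of an `srg(333,166,82,83)` (the windows of
`ConferenceGraph333PrimeSpectrum` are `11, 0, 5, 1 < p`). -/
theorem autGroup_card_not_dvd_23_37_41_83_sq (hV : Fintype.card V = 333) (A : Matrix V V ℤ)
    (h01 : ∀ x y, A x y = 0 ∨ A x y = 1) (hsymm : ∀ x y, A y x = A x y) (hdiag : ∀ x, A x x = 0)
    (hk : ∀ x, ∑ y, A x y = 166) (hsrg : ∀ x y, ∑ z, A x z * A z y = 83 * (1 + (if x = y then 1 else 0)) - A x y)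
    (G : Subgroup (Equiv.Perm V)) (hG : ∀ g ∈ G, ∀ x y, A (g x) (g y) = A x y) :
    ¬ 23 ^ 2 ∣ Nat.card G ∧ ¬ 37 ^ 2 ∣ Nat.card G ∧ ¬ 41 ^ 2 ∣ Nat.card G ∧ ¬ 83 ^ 2 ∣ Nat.card G := by
  have hw : ∀ {p : ℕ} (hp : p.Prime) (hp2 : p ≠ 2), (p = 23 ∨ p = 37 ∨ p = 41 ∨ p = 83) →
      ∀ σ : Equiv.Perm V, σ ^ p = 1 → σ ≠ 1 → (∀ x y, A (σ x) (σ y) = A x y) →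
        (univ.filter fun x => σ x = x).card < p := by
    intro p hp hp2 hps σ hσ hσ1 hA
    obtain ⟨-, -, -, -, -, -, h23, h37, h41, h83⟩ :=
      aut_prime_windows hV A h01 hsymm hdiag hk hsrg hp hp2 σ hσ hσ1 hA
    rcases hps with rfl | rfl | rfl | rfl
    · have := h23 rfl; omega
    · have := h37 rfl; omega
    · have := h41 rfl; omega
    · have := h83 rfl; omega
  refine ⟨?_, ?_, ?_, ?_⟩
  · exact autGroup_sq_not_dvd_card A G hG (by norm_num) (by rw [hV]; norm_num)
      (hw (by norm_num) (by norm_num) (Or.inl rfl))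
  · exact autGroup_sq_not_dvd_card A G hG (by norm_num) (by rw [hV]; norm_num)
      (hw (by norm_num) (by norm_num) (Or.inr (Or.inl rfl)))
  · exact autGroup_sq_not_dvd_card A G hG (by norm_num) (by rw [hV]; norm_num)
      (hw (by norm_num) (by norm_num) (Or.inr (Or.inr (Or.inl rfl))))
  · exact autGroup_sq_not_dvd_card A G hG (by norm_num) (by rw [hV]; norm_num)
      (hw (by norm_num) (by norm_num) (Or.inr (Or.inr (Or.inr rfl))))

end sylow

end Summit.Ventures.DiscreteObjects.Hadamard
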